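import Literature.Computability.AlgebraicComplexity.BILPS19LatinRectangleConditionEventually
import HarnessLib

/-!
# Kumar's stretching theorem `m λ ∈ S(Det_m)` WITHOUT the Alon–Tarsi hypothesis for short partitions:
# `ℓ(λ) ≤ 12` (every even `m`), or `m ≥ 2 ℓ(λ)²`

Bürgisser–Hüttenhain–Ikenmeyer 2017, Thm. 2 (Kumar 2015, Cor. 6.2) — tree fact `Kumar2015_stretching`
(file `NotViaSaturations.lean`, DISCHARGED as `Kumar2015_stretching_holds` in
`NotViaSaturationsProofs.lean`): "Let `n` be even. If the Alon-Tarsi conjecture for `n × n` latin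
squares holds, then `nλ ∈ S(Det_n)` for all partitions `λ` such that `ℓ(λ) ≤ n`." The tree's proof
goes through Kumar's Thm. 6.1: the rectangle `m δ_i = i × m` occurs in `ℂ[Ω_m]`, `Ω_m` the orbit
closure of `det_m`, as soon as Kumar's design polynomial `designPoly i m` is nonzero
(`hasHighestWeight_detOrbitRep_rectWeight`, there fed by `latinColCount m ≠ 0`, i.e. Alon–Tarsi).

By the x5 files `BILPS19LatinRectangleConditionAlonTarsi.lean` /
`BILPS19LatinRectangleConditionAdditivity.lean` / `BILPS19LatinRectangleConditionEventually.lean`,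
`designPoly i m ≠ 0` is EXACTLY the Latin-rectangle condition `LRC(i, m)` of BILPS 2019
(`latinRectangleCondition_iff_designPoly_ne_zero`), which the tree now proves UNCONDITIONALLY for
`i ≤ 12` and every even `m ≥ i`, and for every `i` once `m` is even and `m ≥ 2 i²`. This
theorem-only file threads that through Kumar's argument:

* `hasHighestWeight_detOrbitRep_rectWeight_of_latinRectangleCondition`,
  `rectColWeight_mem_detOccWeights_of_latinRectangleCondition` — **Kumar Thm. 6.1 under `LRC(i, m)`**:
  `m δ_i ∈ S(Det_m)` (same proof as the tree's, with the design-polynomial input supplied by `LRC`).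
* `Kumar2015_stretching_of_latinRectangleCondition` — **`m λ ∈ S(Det_m)` for every partition `λ`
  with `ℓ(λ) ≤ m` and `LRC(ℓ(λ), m)`** (Kumar Cor. 6.2: `m λ = ∑_i (λ_i − λ_{i+1}) · m δ_i` over
  `i ≤ ℓ(λ)`, and `LRC(ℓ(λ), m) ⇒ LRC(i, m)` for `i ≤ ℓ(λ)` by row monotonicity).
* UNCONDITIONAL corollaries: `Kumar2015_stretching_of_length_le_twelve` — **for every even `m` and
  every partition `λ` with `ℓ(λ) ≤ min(12, m)`: `m λ ∈ S(Det_m)`**;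
  `Kumar2015_stretching_of_two_mul_length_sq_le` — the same for every even `m ≥ 2 ℓ(λ)²`
  (`ℓ(λ) ≤ m`).

So the Alon–Tarsi hypothesis of BHI Thm. 2 is now needed in the tree only for partitions with more
than `12` parts in the window `ℓ(λ) ≤ m < 2 ℓ(λ)²` (and `m ≤ 24` or `m = p ± 1` are unconditional
anyway). Honest framing (val-lit): occurrences IN `ℂ[Ω_m]` (the barrier side of occurrence
obstructions, cf. `NotViaSaturations`); nothing here is an obstruction and nothing bears on
`VP ≠ VNP`. No definitions, no named facts.

## References
* [BurgisserHuttenhainIkenmeyer2017] P. Bürgisser, J. Hüttenhain, C. Ikenmeyer, *Permanent versus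
  determinant: not via saturations*, Proc. AMS 145 (2017), Thm. 2.
* [Kumar2015] S. Kumar, Compositio Math. 151 (2015), Thm. 6.1, Cor. 6.2, Thm. 5.6.
* [BlaserIkenmeyerLysikovPandeySchreyer2019] arXiv:1911.02534, §7.3 (Conj. 26 = `LRC`).
-/

noncomputable section

open Equiv Finset MvPolynomial

namespace Literature.Barriers.ValiantsHypothesis

open Literature.NumberTheory.DiophantineGeometry Literature.Computability.AlgebraicComplexity
  Literature.Computability.AlgebraicComplexity.Kumar2015 Literature.Computability.Complexity
  Literature.Computability.AlgebraicComplexity.BILPS2019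

variable {m : ℕ}

/-- **Kumar Thm. 6.1 under `LRC(i, m)`**: if the Latin-rectangle condition `LRC(i, m)` holds (equivalently
Kumar's design polynomial `designPoly i m ≠ 0`), the weight `rectWeight m t` on the top `i` matrix
letters (the dual of the rectangle `i × m = m δ_i`) occurs in `ℂ[Ω_m]`. Proof verbatim as the tree's
`hasHighestWeight_detOrbitRep_rectWeight`, with the design-polynomial input supplied by
`latinRectangleCondition_iff_designPoly_ne_zero` instead of `latinColCount m ≠ 0`.
[cite: Kumar2015, Thm. 6.1] -/
theorem hasHighestWeight_detOrbitRep_rectWeight_of_latinRectangleCondition (m i : ℕ)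
    (hi : i ≤ m * m) (hL : latinRectangleCondition i m) :
    HasHighestWeight (detOrbitRep ℂ m) (rectWeight m (topLetters m i hi)) := by
  classical
  have hF := hyperdetPoly_mem_highestWeightSpace (k := ℂ) (ℓ := m) (topLetters_strictMono m i hi)
    (topLetters_upper m i hi)
  refine hasHighestWeight_orbitCoordRep_of_not_mem _ m hF ?_
  have hP : designPoly i m ≠ 0 := latinRectangleCondition_iff_designPoly_ne_zero.mp hL
  obtain ⟨c, hc⟩ : ∃ c : Fin m × Fin i → ℂ, aeval c (designPoly i m) ≠ 0 := by
    by_contra hcon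
    push Not at hcon
    apply hP
    apply MvPolynomial.map_injective (Int.castRingHom ℂ) Int.cast_injective
    rw [map_zero]
    apply MvPolynomial.funext
    intro c
    rw [eval_map, map_zero]
    have := hcon c
    rwa [aeval_def, algebraMap_int_eq] at this
  have hval : aeval (formCoeff m (linProd c (topLetters m i hi)))
      (hyperdetPoly m (topLetters m i hi) : MvPolynomial (DegIdx (MatIdx m) m) ℂ) ≠ 0 := by
    rw [aeval_formCoeff_hyperdetPoly,
      hyperdet_arrOf_linProd c (topLetters_strictMono m i hi).injective]
    exact mul_ne_zero (pow_ne_zero _ (inv_ne_zero (Nat.cast_ne_zero.mpr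
      (Nat.factorial_ne_zero m)))) hc
  intro hI
  exact hval (aeval_formCoeff_eq_zero_of_mem_orbitClosure_detFormLex
    (linProd_mem_orbitClosure_detFormLex c _) hI)

/-- **`m δ_i ∈ S(Det_m)` under `LRC(i, m)`** (`i ≤ m`). [cite: Kumar2015, Thm. 6.1] -/
theorem rectColWeight_mem_detOccWeights_of_latinRectangleCondition {i : ℕ} (hi : i ≤ m)
    (hL : latinRectangleCondition i m) : rectColWeight m i ∈ detOccWeights m := by
  have hiN : i ≤ m * m := hi.trans (Nat.le_mul_self m)
  rw [mem_detOccWeights_iff, dual_rectColWeight_toMatIdx m i hiN]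
  exact hasHighestWeight_detOrbitRep_rectWeight_of_latinRectangleCondition m i hiN hL

/-- **Kumar's stretching under `LRC(ℓ(λ), m)`**: for a partition `λ` with `ℓ(λ) ≤ m` such that the
Latin-rectangle condition `LRC(ℓ(λ), m)` holds, `m λ ∈ S(Det_m)`. (Column decomposition
`m λ = ∑_{i<m} (λ_{i+1} − λ_{i+2}) · m δ_{i+1}`, `smul_ofPartition_eq_sum`; the coefficients vanish
for `i + 1 > ℓ(λ)`, and for `i + 1 ≤ ℓ(λ)` row monotonicity `latinRectangleCondition_anti` gives
`LRC(i+1, m)`.) [cite: Kumar2015, Cor. 6.2] [cite: BurgisserHuttenhainIkenmeyer2017, Thm. 2] -/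
theorem Kumar2015_stretching_of_latinRectangleCondition {D : ℕ} (lam : Nat.Partition D)
    (hlam : lam.parts.card ≤ m) (hL : latinRectangleCondition lam.parts.card m) :
    m • Weight.ofPartition (m * m) lam ∈ detOccWeights m := by
  rw [smul_ofPartition_eq_sum lam hlam]
  refine AddSubmonoid.sum_mem _ fun i hi => ?_
  rw [Finset.mem_range] at hi
  by_cases hil : i + 1 ≤ lam.parts.card
  · exact AddSubmonoid.nsmul_mem _
      (rectColWeight_mem_detOccWeights_of_latinRectangleCondition hi
        (latinRectangleCondition_anti hil hL)) _
  · have h0 : lam.sortedParts.getD i 0 = 0 :=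
      List.getD_eq_default _ _ (by rw [Nat.Partition.length_sortedParts]; omega)
    have h1 : lam.sortedParts.getD (i + 1) 0 = 0 :=
      List.getD_eq_default _ _ (by rw [Nat.Partition.length_sortedParts]; omega)
    rw [h0, h1, Nat.sub_zero, zero_smul]
    exact AddSubmonoid.zero_mem _

/-- **Kumar's stretching UNCONDITIONALLY for partitions with at most `12` parts**: for every even `m`
and every partition `λ` with `ℓ(λ) ≤ 12` and `ℓ(λ) ≤ m`, `m λ ∈ S(Det_m)` — BHI Thm. 2 with its
Alon–Tarsi hypothesis replaced by the tree theorem `latinRectangleCondition_of_le_twelve`.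
[cite: BurgisserHuttenhainIkenmeyer2017, Thm. 2 (Kumar)] -/
theorem Kumar2015_stretching_of_length_le_twelve (m : ℕ) (hm : Even m) {D : ℕ}
    (lam : Nat.Partition D) (h12 : lam.parts.card ≤ 12) (hlam : lam.parts.card ≤ m) :
    m • Weight.ofPartition (m * m) lam ∈ detOccWeights m :=
  Kumar2015_stretching_of_latinRectangleCondition lam hlam
    (latinRectangleCondition_of_le_twelve h12 hlam hm)

/-- **Kumar's stretching UNCONDITIONALLY for `m ≥ 2 ℓ(λ)²`**: for every even `m` and every partition
`λ` with `ℓ(λ) ≤ m` and `2 ℓ(λ)² ≤ m`, `m λ ∈ S(Det_m)` (via `latinRectangleCondition_of_two_mul_sq_le`: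
Bertrand + Drisko/Glynn + block additivity). [cite: BurgisserHuttenhainIkenmeyer2017, Thm. 2 (Kumar)] -/
theorem Kumar2015_stretching_of_two_mul_length_sq_le (m : ℕ) (hm : Even m) {D : ℕ}
    (lam : Nat.Partition D) (hlam : lam.parts.card ≤ m) (hsq : 2 * lam.parts.card ^ 2 ≤ m) :
    m • Weight.ofPartition (m * m) lam ∈ detOccWeights m :=
  Kumar2015_stretching_of_latinRectangleCondition lam hlam
    (latinRectangleCondition_of_two_mul_sq_le hsq hm)

/-- The rectangles themselves: `m δ_i ∈ S(Det_m)` for every even `m` and `i ≤ min(12, m)`,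
unconditionally. [cite: Kumar2015, Thm. 6.1] -/
theorem rectColWeight_mem_detOccWeights_of_le_twelve (hm : Even m) {i : ℕ} (h12 : i ≤ 12)
    (hi : i ≤ m) : rectColWeight m i ∈ detOccWeights m :=
  rectColWeight_mem_detOccWeights_of_latinRectangleCondition hi
    (latinRectangleCondition_of_le_twelve h12 hi hm)

end Literature.Barriers.ValiantsHypothesis
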